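import Literature.NumberTheory.EllipticCurves.Muller2020.MainConjectureSplitTwo
import Literature.NumberTheory.EllipticCurves.IntSeriesNodeTransportShiftedNodes
import HarnessLib

set_option autoImplicit false

/-!
# Period-pair rigidity for `ν`-branches on one `ℤ_p`-line: two integral series taking the
# interpolation values `interpolationValue₀` at TWO admissible period pairs `(Ω, Ω_p)`, `(Ω', Ω_p')`
# along a node family `w·uᵗ − 1` generate the SAME ideal of `𝒪_{ℂ_p}⟦T⟧` (PROVED; no unit content)

Topic `Literature/NumberTheory/EllipticCurves` (grouping sub-namespace `Muller2020`), sequel of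
`Muller2020/MainConjectureSplitTwo.lean` (`interpolationValue₀`, `IsNuBranch`) and of
`IntSeriesNodeTransportShiftedNodes.lean` (transport along shifted nodes). THEOREMS ONLY (no
definition, no named fact, no `sorry`, no `instance`). Typed by the discharge-interface typer
`bsd-print-cf2-ty2` (cell `bsd-print-cf2`) as the RIGIDITY half of input **(A)** of the M-LINE-PIN
on crux `PrintCf2RubinValueTwo.MainConjClauseAtSplitTwoQuad` (stmt-BirchSwinnertonDyer-24086, stub
`stub_vLineRestriction`; LEAD ruling HOME/STATUS 2026-08-29T07:47:41Z (3)/(5): "the one-variable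
`IsNuBranch` shadow — same modulus, two admissible period pairs ⟹ equal spans"). HONEST FRAMING:
nothing here concerns an elliptic curve over `ℚ`; BSD is not proved by any of this.

## The statement and why no `μ`-input is needed

de Shalit 1987, II.4.12 Remarks (iii)–(iv) (store chunk 66–67): the period pair `(Ω, Ω_p)` of the
interpolation formula (31)/(50) is determined up to a common unit, and two measures with the
interpolation property for two admissible pairs differ by the corresponding twist. In the tree's
"power series language" along a `ℤ_p`-line (`1 + T ↔ γ`): let `P, Q ∈ 𝒪_{ℂ_p}⟦T⟧` take, at the nodes
`x_t = w·uᵗ − 1` (`t ∈ ℕ`; `w, u` one-units, `u` not a root of unity — the nodes `r_t(γ) − 1` of a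
family of in-range characters `ρ_t = ρ_* Ψᵗ`), the values

  `P(x_t) = ι⁻¹(interpolationValue₀ p v T ε_t m_t Ω L_t) · Ω_p^{m_t}`,
  `Q(x_t) = ι⁻¹(interpolationValue₀ p v T ε_t m_t Ω' L_t) · Ω_p'^{m_t}`,

with the SAME characters `ε_t`, `L`-values `L_t` and types `m_t = m₀ + m₁·t` (`m₁ > 0`). Since
`interpolationValue₀ … Ω L = (Ω'/Ω)^m · interpolationValue₀ … Ω' L`
(`interpolationValue₀_eq_mul_of_ne_zero`), `P(x_t) = A^{m_t} Q(x_t)` with the PERIOD RATIO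
`A = ι⁻¹(Ω'/Ω)·Ω_p/Ω_p'`, i.e. `P(x_t) = c·dᵗ·Q(x_t)`, `c = A^{m₀}`, `d = A^{m₁}`. If `Q ≠ 0` the node
transport (`IntSeries.norm_eq_one_of_shifted_values_proportional`: `d = u^z` is a one-unit) gives
`‖A‖ = 1` — `norm_periodRatio_eq_one`, with NO unit-content / `μ = 0` hypothesis on either series —
hence `c ∈ 𝒪_{ℂ_p}ˣ` and (`IntSeries.span_eq_span_of_shifted_values_proportional`)
**`Ideal.span {P} = Ideal.span {Q}`** (`span_eq_span_of_interpolationValue₀_values`), and `P ≠ 0`.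

USE: `P = π_v(G₂)` (the restriction of a two-variable Katz measure to the `v`-line, an
`IsNuBranch ι v (insert v̄ S) κ₁ γ₁⁻¹ θ_K⁻¹ Ω Ω_p` solution) and `Q = E_v̄ · G₁` (Müller's branch times
the Euler factor at `v̄`, whose values at the in-range points are the `Ω'`-interpolation values by
`IsNuBranch.hasValueAt_insert_of_avatarAt_inv`); the character supply `ρ_* Ψᵗ` on the `v`-line is
the consumer's (Summits side).

## References
* [deShalit1987] II Thm. 4.12 (31) and Remarks (iii)–(iv) (store chunk 66–67), II.4.16 (49)–(50)
  (store chunk 76–77), II.4.17 (52) (store chunk 77).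
* [Muller2020SplitPrimeTwo] Thm. 2.4 (arXiv p0006:L19–26) (the one-period interpolation value).
* [Gouvea1993PadicNumbers] §5.9 Lemma 5.9.1, Problem 194; §5.6 Cor. 5.6.4.
* Tree: `Muller2020/MainConjectureSplitTwo.lean` (`interpolationValue₀`),
  `IntSeriesNodeTransportShiftedNodes.lean`, `IntSeriesNodeTransportNoUnitContent.lean` (cf2c-w3).
-/

noncomputable section

open scoped Classical
open NumberField IsDedekindDomain Field
open Literature.NumberTheory.GaloisRepresentations

namespace Literature.NumberTheory.EllipticCurves.Muller2020

universe u

variable {p : ℕ} [Fact p.Prime] {K : Type u} [Field K] [NumberField K]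

/-! ### §1. The interpolation value scales with the period: `Ω ↦ Ω'` multiplies by `(Ω'/Ω)^m` -/

omit [Fact p.Prime] in
/-- **`interpolationValue₀ … Ω L = (Ω'/Ω)^m · interpolationValue₀ … Ω' L`** (`Ω, Ω' ≠ 0`): the only
dependence on the period is the factor `(Ω^m)⁻¹`. [cite: deShalit1987, II Thm. 4.12 (31) and Remark (iii) (store chunk 66–67)]
[cite: Muller2020SplitPrimeTwo, Thm. 2.4 (arXiv p0006:L19–26)] -/
theorem interpolationValue₀_eq_mul_of_ne_zero (v : HeightOneSpectrum (𝓞 K))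
    (T : Finset (HeightOneSpectrum (𝓞 K))) (ε : HeckeCharacter K) (m : ℕ) {Ω Ω' : ℂ} (hΩ : Ω ≠ 0)
    (hΩ' : Ω' ≠ 0) (Lval : ℂ) :
    interpolationValue₀ p v T ε m Ω Lval = (Ω' / Ω) ^ m * interpolationValue₀ p v T ε m Ω' Lval := by
  unfold interpolationValue₀
  have h : (Ω ^ m)⁻¹ = (Ω' / Ω) ^ m * (Ω' ^ m)⁻¹ := by
    rw [div_pow]; field_simp
  rw [h]; ring

/-! ### §2. Period-pair rigidity along a shifted node family -/

section Rigidity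

variable {ι : PadicAlgCl p ≃+* ℂ} {v : HeightOneSpectrum (𝓞 K)} {T : Finset (HeightOneSpectrum (𝓞 K))}
  {ε : ℕ → HeckeCharacter K} {m : ℕ → ℕ} {m₀ m₁ : ℕ} {L : ℕ → ℂ}
  {Ω Ω' : ℂ} {Ωp Ωp' : ℂ_[p]} {P Q : PowerSeries (PadicComplexInt p)}
  {w : PadicComplexInt p} {u : ℂ_[p]}

/-- The coefficient map `ℂ → ℂ_p`, `z ↦ ι⁻¹(z)` read in the completion (private abbreviation of
the double coercion). [cite: deShalit1987, II.4.16 (49)–(50) (store chunk 76–77)] -/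
private theorem coe_symm_eq_comp (ι : PadicAlgCl p ≃+* ℂ) (z : ℂ) :
    ((ι.symm z : PadicAlgCl p) : ℂ_[p]) =
      ((algebraMap (PadicAlgCl p) ℂ_[p]).comp ι.symm.toRingHom) z := by
  rw [RingHom.coe_comp, Function.comp_apply, PadicComplex.coe_eq]; rfl

/-- `ι⁻¹(z) ≠ 0` in `ℂ_p` for `z ≠ 0`. [cite: deShalit1987, II.4.16 (49)–(50) (store chunk 76–77)] -/
theorem coe_symm_ne_zero (ι : PadicAlgCl p ≃+* ℂ) {z : ℂ} (hz : z ≠ 0) :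
    ((ι.symm z : PadicAlgCl p) : ℂ_[p]) ≠ 0 := by
  rw [coe_symm_eq_comp]; exact (map_ne_zero _).mpr hz

/-- **The two value families are proportional by powers of the period ratio**: with
`A = ι⁻¹(Ω'/Ω)·Ω_p·Ω_p'⁻¹`, the `(Ω, Ω_p)`-value is `A^m` times the `(Ω', Ω_p')`-value.
[cite: deShalit1987, II Thm. 4.12 (31) and Remarks (iii)–(iv) (store chunk 66–67)] -/
theorem interpolationValue₀_periods_proportional (hΩ : Ω ≠ 0) (hΩ' : Ω' ≠ 0) (hΩp' : Ωp' ≠ 0)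
    (e : HeckeCharacter K) (n : ℕ) (Lval : ℂ) :
    ((ι.symm (interpolationValue₀ p v T e n Ω Lval) : PadicAlgCl p) : ℂ_[p]) * Ωp ^ n =
      (((ι.symm (Ω' / Ω) : PadicAlgCl p) : ℂ_[p]) * Ωp * Ωp'⁻¹) ^ n *
        (((ι.symm (interpolationValue₀ p v T e n Ω' Lval) : PadicAlgCl p) : ℂ_[p]) * Ωp' ^ n) := by
  set φ : ℂ →+* ℂ_[p] := (algebraMap (PadicAlgCl p) ℂ_[p]).comp ι.symm.toRingHom with hφ_def
  simp only [coe_symm_eq_comp, ← hφ_def]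
  rw [interpolationValue₀_eq_mul_of_ne_zero (p := p) v T e n hΩ hΩ' Lval, map_mul, map_pow]
  have h : (Ωp' : ℂ_[p]) ^ n * (Ωp'⁻¹) ^ n = 1 := by
    rw [← mul_pow, mul_inv_cancel₀ hΩp', one_pow]
  linear_combination
    -((φ (Ω' / Ω)) ^ n * φ (interpolationValue₀ p v T e n Ω' Lval) * Ωp ^ n) * h

/-- **The period ratio of two value families realised by integral series is a UNIT** (no unit
content needed). If `P, Q ∈ 𝒪_{ℂ_p}⟦T⟧` take at the nodes `w uᵗ − 1` (`w, u` one-units, `u` not a root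
of unity) the interpolation values for `(Ω, Ω_p)` resp. `(Ω', Ω_p')` at the same characters and types
`m_t = m₀ + m₁t`, `m₁ > 0`, and `Q ≠ 0`, then `‖ι⁻¹(Ω'/Ω)·Ω_p·Ω_p'⁻¹‖ = 1`.
[cite: deShalit1987, II Thm. 4.12 Remarks (iii)–(iv) (store chunk 66–67)] [cite: Gouvea1993PadicNumbers, §5.9 Problem 194] -/
theorem norm_periodRatio_eq_one (hw : ‖(w : ℂ_[p]) - 1‖ < 1) (hu : ‖u - 1‖ < 1)
    (hroot : ∀ n : ℕ, 0 < n → u ^ n ≠ 1) (hm : ∀ t : ℕ, m t = m₀ + m₁ * t) (hm₁ : 0 < m₁)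
    (hΩ : Ω ≠ 0) (hΩ' : Ω' ≠ 0) (hΩp : Ωp ≠ 0) (hΩp' : Ωp' ≠ 0)
    (hP : ∀ t : ℕ, IntSeries.HasValueAt P ((w : ℂ_[p]) * u ^ t - 1)
      (((ι.symm (interpolationValue₀ p v T (ε t) (m t) Ω (L t)) : PadicAlgCl p) : ℂ_[p]) * Ωp ^ (m t)))
    (hQ : ∀ t : ℕ, IntSeries.HasValueAt Q ((w : ℂ_[p]) * u ^ t - 1)
      (((ι.symm (interpolationValue₀ p v T (ε t) (m t) Ω' (L t)) : PadicAlgCl p) : ℂ_[p]) * Ωp' ^ (m t)))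
    (hQ0 : Q ≠ 0) :
    ‖((ι.symm (Ω' / Ω) : PadicAlgCl p) : ℂ_[p]) * Ωp * Ωp'⁻¹‖ = 1 := by
  set A : ℂ_[p] := ((ι.symm (Ω' / Ω) : PadicAlgCl p) : ℂ_[p]) * Ωp * Ωp'⁻¹ with hA_def
  have hA0 : A ≠ 0 := by
    refine mul_ne_zero (mul_ne_zero ?_ hΩp) (inv_ne_zero hΩp')
    exact coe_symm_ne_zero ι (div_ne_zero hΩ' hΩ)
  have hrel : ∀ t : ℕ,
      ((ι.symm (interpolationValue₀ p v T (ε t) (m t) Ω (L t)) : PadicAlgCl p) : ℂ_[p]) * Ωp ^ (m t) =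
        A ^ m₀ * (A ^ m₁) ^ t *
          (((ι.symm (interpolationValue₀ p v T (ε t) (m t) Ω' (L t)) : PadicAlgCl p) : ℂ_[p]) *
            Ωp' ^ (m t)) := fun t ↦ by
    rw [interpolationValue₀_periods_proportional hΩ hΩ' hΩp' (ε t) (m t) (L t), ← hA_def, hm t,
      pow_add, pow_mul]
  obtain ⟨t₀, ht₀⟩ := IntSeries.exists_node_value_ne_zero hQ0 hw hu hroot hQ
  have hd : ‖A ^ m₁‖ = 1 :=
    IntSeries.norm_eq_one_of_shifted_values_proportional hw hu hroot (pow_ne_zero _ hA0)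
      (pow_ne_zero _ hA0) hQ hP hrel ht₀
  rw [norm_pow] at hd
  exact (pow_eq_one_iff_of_ne_zero hm₁.ne').mp hd |>.resolve_right (by
    intro h; exact absurd h.1 (by linarith [norm_nonneg A]))

/-- **Period-pair rigidity: `Ideal.span {P} = Ideal.span {Q}` in `𝒪_{ℂ_p}⟦T⟧`.** In the setting of
`norm_periodRatio_eq_one` (two integral series realising the interpolation values at two admissible
period pairs along the shifted node family, `Q ≠ 0`): `P = U·Q` for a unit `U` of `𝒪_{ℂ_p}⟦T⟧`
(`U = c₀·(1+T)^z` read through the unit twist by `w`, `c₀ = A^{m₀}`), hence the two series generate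
the same ideal. [cite: deShalit1987, II Thm. 4.12 Remarks (iii)–(iv) (store chunk 66–67), II.4.17 (52) (store chunk 77)]
[cite: Gouvea1993PadicNumbers, §5.9 Lemma 5.9.1 and Problem 194] -/
theorem span_eq_span_of_interpolationValue₀_values (hw : ‖(w : ℂ_[p]) - 1‖ < 1) (hu : ‖u - 1‖ < 1)
    (hroot : ∀ n : ℕ, 0 < n → u ^ n ≠ 1) (hm : ∀ t : ℕ, m t = m₀ + m₁ * t) (hm₁ : 0 < m₁)
    (hΩ : Ω ≠ 0) (hΩ' : Ω' ≠ 0) (hΩp : Ωp ≠ 0) (hΩp' : Ωp' ≠ 0)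
    (hP : ∀ t : ℕ, IntSeries.HasValueAt P ((w : ℂ_[p]) * u ^ t - 1)
      (((ι.symm (interpolationValue₀ p v T (ε t) (m t) Ω (L t)) : PadicAlgCl p) : ℂ_[p]) * Ωp ^ (m t)))
    (hQ : ∀ t : ℕ, IntSeries.HasValueAt Q ((w : ℂ_[p]) * u ^ t - 1)
      (((ι.symm (interpolationValue₀ p v T (ε t) (m t) Ω' (L t)) : PadicAlgCl p) : ℂ_[p]) * Ωp' ^ (m t)))
    (hQ0 : Q ≠ 0) :
    Ideal.span ({P} : Set (PowerSeries (PadicComplexInt p))) = Ideal.span {Q} := by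
  set A : ℂ_[p] := ((ι.symm (Ω' / Ω) : PadicAlgCl p) : ℂ_[p]) * Ωp * Ωp'⁻¹ with hA_def
  have hA1 : ‖A‖ = 1 := norm_periodRatio_eq_one hw hu hroot hm hm₁ hΩ hΩ' hΩp hΩp' hP hQ hQ0
  have hA0 : A ≠ 0 := norm_pos_iff.mp (by rw [hA1]; exact one_pos)
  -- the constant `c₀ = A^{m₀}` as a unit of `𝒪_{ℂ_p}`
  set A₀ : PadicComplexInt p := ⟨A, mem_padicComplexInt_iff.mpr hA1.le⟩ with hA₀_def
  have hA₀c : ((A₀ ^ m₀ : PadicComplexInt p) : ℂ_[p]) = A ^ m₀ := by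
    push_cast; rw [hA₀_def]
  have hcu : IsUnit (A₀ ^ m₀) := by
    rw [isUnit_padicComplexInt_iff, hA₀c, norm_pow, hA1, one_pow]
  have hrel : ∀ t : ℕ,
      ((ι.symm (interpolationValue₀ p v T (ε t) (m t) Ω (L t)) : PadicAlgCl p) : ℂ_[p]) * Ωp ^ (m t) =
        ((A₀ ^ m₀ : PadicComplexInt p) : ℂ_[p]) * (A ^ m₁) ^ t *
          (((ι.symm (interpolationValue₀ p v T (ε t) (m t) Ω' (L t)) : PadicAlgCl p) : ℂ_[p]) *
            Ωp' ^ (m t)) := fun t ↦ by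
    rw [hA₀c, interpolationValue₀_periods_proportional hΩ hΩ' hΩp' (ε t) (m t) (L t), ← hA_def,
      hm t, pow_add, pow_mul]
  obtain ⟨t₀, ht₀⟩ := IntSeries.exists_node_value_ne_zero hQ0 hw hu hroot hQ
  exact IntSeries.span_eq_span_of_shifted_values_proportional hw hu hroot hcu (pow_ne_zero _ hA0)
    hQ hP hrel ht₀

/-- **`P ≠ 0`** in the same setting (a non-zero node value of `Q` transports to one of `P`).
[cite: deShalit1987, II Thm. 4.12 Remarks (iii)–(iv) (store chunk 66–67)] [cite: Gouvea1993PadicNumbers, §5.6 Cor. 5.6.4] -/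
theorem ne_zero_of_interpolationValue₀_values (hw : ‖(w : ℂ_[p]) - 1‖ < 1) (hu : ‖u - 1‖ < 1)
    (hroot : ∀ n : ℕ, 0 < n → u ^ n ≠ 1)
    (hΩ : Ω ≠ 0) (hΩ' : Ω' ≠ 0) (hΩp : Ωp ≠ 0) (hΩp' : Ωp' ≠ 0)
    (hP : ∀ t : ℕ, IntSeries.HasValueAt P ((w : ℂ_[p]) * u ^ t - 1)
      (((ι.symm (interpolationValue₀ p v T (ε t) (m t) Ω (L t)) : PadicAlgCl p) : ℂ_[p]) * Ωp ^ (m t)))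
    (hQ : ∀ t : ℕ, IntSeries.HasValueAt Q ((w : ℂ_[p]) * u ^ t - 1)
      (((ι.symm (interpolationValue₀ p v T (ε t) (m t) Ω' (L t)) : PadicAlgCl p) : ℂ_[p]) * Ωp' ^ (m t)))
    (hQ0 : Q ≠ 0) : P ≠ 0 := by
  set A : ℂ_[p] := ((ι.symm (Ω' / Ω) : PadicAlgCl p) : ℂ_[p]) * Ωp * Ωp'⁻¹ with hA_def
  have hA0 : A ≠ 0 := by
    refine mul_ne_zero (mul_ne_zero ?_ hΩp) (inv_ne_zero hΩp')
    exact coe_symm_ne_zero ι (div_ne_zero hΩ' hΩ)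
  -- here the exponent is used unsplit: `c = 1`, `d`-free bookkeeping via `A^{m t}`
  have hrel : ∀ t : ℕ,
      ((ι.symm (interpolationValue₀ p v T (ε t) (m t) Ω (L t)) : PadicAlgCl p) : ℂ_[p]) * Ωp ^ (m t) =
        A ^ (m t) * (1 : ℂ_[p]) ^ t *
          (((ι.symm (interpolationValue₀ p v T (ε t) (m t) Ω' (L t)) : PadicAlgCl p) : ℂ_[p]) *
            Ωp' ^ (m t)) := fun t ↦ by
    rw [interpolationValue₀_periods_proportional hΩ hΩ' hΩp' (ε t) (m t) (L t), ← hA_def, one_pow,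
      mul_one]
  obtain ⟨t₀, ht₀⟩ := IntSeries.exists_node_value_ne_zero hQ0 hw hu hroot hQ
  intro hP0
  have h1 : ((ι.symm (interpolationValue₀ p v T (ε t₀) (m t₀) Ω (L t₀)) : PadicAlgCl p) : ℂ_[p]) *
      Ωp ^ (m t₀) = 0 := by
    have h := hP t₀
    rw [hP0] at h
    have hz : IntSeries.HasValueAt (0 : PowerSeries (PadicComplexInt p)) ((w : ℂ_[p]) * u ^ t₀ - 1) 0 := by
      unfold IntSeries.HasValueAt; simp
    exact HasSum.unique h hz
  rw [hrel t₀, one_pow, mul_one] at h1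
  exact (mul_ne_zero (pow_ne_zero _ hA0) ht₀) h1

end Rigidity

end Literature.NumberTheory.EllipticCurves.Muller2020

end
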